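import Mathlib

/-!
# Sketch (ns-idea-12 g6) — first lemmas of the crux idea `la-rigid-core`
(Lundgren–Ashurst / Callegari–Ting axial core dynamics vs the FSR passive area clause).
Pure real analysis; MODEL-TOY closure constants are parameters (`kG2` = k·G², `cν`).
-/

set_option linter.dupNamespace false

namespace Summit.NavierStokesRegularity.NavierStokesRegularity.Cruxes.SelectionBoxRJ.LaRigidCore

open MeasureTheory intervalIntegral Set

/-- FIRST LEMMA (subsonic core rigidity, energy form). Along a steady slender core with area `A > 0`
and core axial speed `W`, the on-axis axial momentum balance `W·W′ = F + kG2·(A⁻¹)′`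
(F = ambient Bernoulli forcing + jet drag, lumped) integrates to
`kG2·|A⁻¹(τ) − A⁻¹(0)| ≤ ½ W(τ)² + ½ W(0)² + ∫₀^τ |F|`: when `kG2 ≫ sup ½W² + ∫|F|` the core area is
rigid (`A ≈ A(0)`), whatever the ambient stretching does. -/
def SubsonicCoreRigidity : Prop :=
  ∀ (kG2 T : ℝ) (Ainv W F : ℝ → ℝ), 0 < kG2 → 0 ≤ T →
    ContDiff ℝ 1 Ainv → ContDiff ℝ 1 W → Continuous F →
    (∀ τ ∈ Icc (0:ℝ) T, W τ * deriv W τ = F τ + kG2 * deriv Ainv τ) →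
    ∀ τ ∈ Icc (0:ℝ) T,
      kG2 * |Ainv τ - Ainv 0| ≤ (W τ) ^ 2 / 2 + (W 0) ^ 2 / 2 + ∫ s in (0:ℝ)..τ, |F s|

/-- SECOND LEMMA (jet-free cores force supercritical ambient stretching EVERYWHERE, not only at the
waist). If the FSR passive clause holds with the ambient slip `w` as transporting speed
(`w·A′ = (3/2 − w′)·A + 4`, i.e. no confined jet, `W = w`) and the core is rigid to tolerance `ε`
(`|w·A′| ≤ ε`, which the first lemma forces on the swirl-dominated range), then
`w′ ≥ 3/2 + (4 − ε)/A` there — incompatible with frame-relaxed arms (`w′ → 1/2`). -/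
def JetFreeForcesSupercritical : Prop :=
  ∀ (A w : ℝ → ℝ) (τ a w' ε : ℝ), 0 < A τ → HasDerivAt A a τ → HasDerivAt w w' τ →
    w τ * a = (3/2 - w') * A τ + 4 → |w τ * a| ≤ ε → 3/2 + (4 - ε) / A τ ≤ w'

/-- The second lemma is elementary (recorded here so the card's `First lemma` is not vacuous). -/
theorem jetFreeForcesSupercritical_holds : JetFreeForcesSupercritical := by
  intro A w τ a w' ε hA hAd hwd hlaw hε
  have h1 : (3/2 - w') * A τ + 4 ≤ ε := by
    have := (abs_le.mp hε).2; linarith [hlaw]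
  have h2 : (4 - ε) / A τ ≤ w' - 3/2 := by
    rw [div_le_iff₀ hA]; nlinarith [h1, hA]
  linarith [h2]


/-- The first lemma is the fundamental theorem of calculus applied to `g = W²/2 − kG2·Ainv` (proved here so the
card's `First lemma` is a theorem, not a promise). -/
theorem subsonicCoreRigidity_holds : SubsonicCoreRigidity := by
  intro kG2 T Ainv W F hk hT hA hW hF hmom τ hτ
  have hτ0 : (0:ℝ) ≤ τ := hτ.1
  -- derivatives of W and Ainv everywhere
  have hWd : ∀ x, HasDerivAt W (deriv W x) x := fun x =>
    ((hW.differentiable (by norm_num)) x).hasDerivAt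
  have hAd : ∀ x, HasDerivAt Ainv (deriv Ainv x) x := fun x =>
    ((hA.differentiable (by norm_num)) x).hasDerivAt
  -- g = W^2/2 - kG2 * Ainv has derivative F on [0, τ]
  set g : ℝ → ℝ := fun s => (W s) ^ 2 / 2 - kG2 * Ainv s with hg
  have hgd : ∀ x ∈ Set.uIcc (0:ℝ) τ, HasDerivAt g (F x) x := by
    intro x hx
    rw [Set.uIcc_of_le hτ0] at hx
    have hx' : x ∈ Icc (0:ℝ) T := ⟨hx.1, le_trans hx.2 hτ.2⟩
    have h1 : HasDerivAt (fun s => (W s) ^ 2 / 2) (W x * deriv W x) x := by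
      have := ((hWd x).pow 2).div_const 2
      simpa [pow_one] using this.congr_deriv (by ring)
    have h2 : HasDerivAt (fun s => kG2 * Ainv s) (kG2 * deriv Ainv x) x := (hAd x).const_mul kG2
    have h3 := h1.sub h2
    have heq : W x * deriv W x - kG2 * deriv Ainv x = F x := by linarith [hmom x hx']
    rw [heq] at h3
    exact h3
  have hFi : IntervalIntegrable F volume (0:ℝ) τ := hF.intervalIntegrable 0 τ
  have hftc : ∫ s in (0:ℝ)..τ, F s = g τ - g 0 :=
    intervalIntegral.integral_eq_sub_of_hasDerivAt hgd hFi
  have habs : |∫ s in (0:ℝ)..τ, F s| ≤ ∫ s in (0:ℝ)..τ, |F s| :=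
    intervalIntegral.abs_integral_le_integral_abs hτ0
  have hid : kG2 * (Ainv τ - Ainv 0) = (W τ) ^ 2 / 2 - (W 0) ^ 2 / 2 - ∫ s in (0:ℝ)..τ, F s := by
    rw [hftc]; simp only [hg]; ring
  have hk' : |kG2| = kG2 := abs_of_pos hk
  calc kG2 * |Ainv τ - Ainv 0| = |kG2 * (Ainv τ - Ainv 0)| := by rw [abs_mul, hk']
    _ = |(W τ) ^ 2 / 2 - (W 0) ^ 2 / 2 - ∫ s in (0:ℝ)..τ, F s| := by rw [hid]
    _ ≤ |(W τ) ^ 2 / 2| + |(W 0) ^ 2 / 2| + |∫ s in (0:ℝ)..τ, F s| := by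
          have := abs_sub ((W τ) ^ 2 / 2 - (W 0) ^ 2 / 2) (∫ s in (0:ℝ)..τ, F s)
          have := abs_sub ((W τ) ^ 2 / 2) ((W 0) ^ 2 / 2)
          linarith
    _ ≤ (W τ) ^ 2 / 2 + (W 0) ^ 2 / 2 + ∫ s in (0:ℝ)..τ, |F s| := by
          rw [abs_of_nonneg (by positivity : (0:ℝ) ≤ (W τ) ^ 2 / 2),
              abs_of_nonneg (by positivity : (0:ℝ) ≤ (W 0) ^ 2 / 2)]
          linarith [habs]

end Summit.NavierStokesRegularity.NavierStokesRegularity.Cruxes.SelectionBoxRJ.LaRigidCore
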